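import Literature.NumberTheory.EllipticCurves.SelmerPInftyRestriction
import Literature.NumberTheory.EllipticCurves.IwasawaSelmerProofs
import Literature.NumberTheory.EllipticCurves.DiscreteH1Equiv
import HarnessLib

/-!
# The subgroup model of `H¹(L̄^{H′}, E_L[p^∞])` inside `Γ_K` for `L/K` algebraic, and the local Selmer condition
# at a common local field (Selmer base change along `L/K`, generic layer)

Serre, *Galois Cohomology*, I.§2.4–2.5, II.§1.1 (restriction along compatible pairs; decomposition groups through a
chosen embedding); Greenberg, LNM 1716 (1999), §1–§2 (Selmer groups over infinite extensions as subgroups of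
`H¹(Gal(K̄/L), E[p^∞])`). The tree's `SelmerPInftyRestriction.modelIso` identifies `H¹(Γ_L, E_L[p^∞])` with
`H¹(galRange L, E[p^∞])` (`galRange L = resGal(Γ_L) ≤ Γ_K`); this file does the same for a closed subgroup
`H′ ≤ Γ_L` (an intermediate extension `L̄^{H′}` of `L`, e.g. the top of a `ℤ_p`-tower over `L`), and compares the LOCAL
Selmer conditions of the two models at a common `L`-field `E` (a completion `L_w`):

* §1 `galImage L H′ = resGal(H′) ≤ Γ_K`; the mutually inverse continuous isomorphisms `toGalImage`, `ofGalImage`;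
  **`subgroupModelIso : (W.baseChange L).subgroupH1 p H′ ≃+ W.subgroupH1 p (galImage L H′)`** (pairs
  `(ofGalImage, primaryBaseChangeEquiv⁻¹)` / `(toGalImage, primaryBaseChangeEquiv)`), and its `conj`-EQUIVARIANCE
  `subgroupModelIso (conj_σ x) = conj_{resGal σ} (subgroupModelIso x)`.
* §2 **the local condition at a common `L`-field `E`**: for `ι′ : L̄ →ₐ[L] Ē` and the composite `K`-embedding
  `ι = ι′ ∘ closureEmb L : K̄ → Ē`, the local subgroups `(H′)_{ι′}` and `(galImage H′)_ι` of `Γ_E` COINCIDE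
  (`localSubgroupOfEmb_galImage_eq`) and **`mem_localKerOverOfEmb_iff_subgroupModelIso_mem`**: `x` dies in
  `H¹((H′)_{ι′}, E_L(Ē))` iff `subgroupModelIso x` dies in `H¹((galImage H′)_ι, E(Ē))` (functoriality along
  `Γ_E → Γ_L → Γ_K`, `resGalOfEmb_comp_tower`, and the identification of coefficients `pointsCongr`).
* §3 **towers of local fields in the base-`K` model**: for `K`-fields `E₁ → E₂` and compatible embeddings
  `ι₂ ∘ ι₁`, `LK_{H,ι₁}(E₁) ≤ LK_{H,ι₂∘ι₁}(E₂)` (`localKerOverOfEmb_le_of_tower`).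

Everything is proved; no named fact, no instance, no `sorry`. Motivation (cell `bsd-2adic`, seat `t42` GEN 23): the
model identification `Sel_{2^∞}((E′)_{ℚ(i)}/ℚ(i)·ℚ_∞) ≅ E′.selmerGroupOver 2 (ker κ ⊓ Stab i)` wanted by
`Theorems/ByReductionTypeAtTwoAdditiveKatoTransportQuadraticLayer` (memo `t42/DESIGN-T42-ADDENDUM-27.md` §A27.3); this file
is its generic layer (B3)+(C2)+(C1-easy). The place bookkeeping (which place `w ∣ v` of `L` matches a given
`K`-embedding `K̄ → (K_v)‾`) is NOT here.

## References

* [SerreGaloisCohomology1997] J.-P. Serre, *Galois Cohomology* (1997), I.§2.4–2.5, II.§1.1.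
* [GreenbergLNM1716] R. Greenberg, LNM 1716 (1999), §1–§2.
* [DokchitserDokchitserAnnals2010] T. Dokchitser, V. Dokchitser, Ann. of Math. 172 (2010), Lemma 4.14 (restriction).
-/

noncomputable section

open scoped Classical

universe u

namespace Literature.NumberTheory.EllipticCurves

namespace BaseChangeModel

open WeierstrassCurve GaloisRepresentations

/-! ## §1 The subgroup model along `L/K` -/

section Model

variable (K : Type u) [Field K] (L : Type u) [Field L] [Algebra K L] [Algebra.IsAlgebraic K L] [PerfectField L]
  (H' : Subgroup (Field.absoluteGaloisGroup L))

/-- `galImage L H′ = resGal(H′) ≤ Γ_K`: the subgroup of `Γ_K` cutting out the same extension `L̄^{H′}` of `K` inside `K̄`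
(`galImage L ⊤ = galRange L`). [cite: SerreGaloisCohomology1997, II.§1.1] -/
def galImage : Subgroup (Field.absoluteGaloisGroup K) :=
  H'.map ((resGal (K := K) L : Field.absoluteGaloisGroup L →ₜ* Field.absoluteGaloisGroup K) :
    Field.absoluteGaloisGroup L →* Field.absoluteGaloisGroup K)

omit [Algebra.IsAlgebraic K L] [PerfectField L] in
/-- Membership in `galImage`. [cite: SerreGaloisCohomology1997, II.§1.1] -/
theorem mem_galImage_iff (g : Field.absoluteGaloisGroup K) :
    g ∈ galImage K L H' ↔ ∃ σ ∈ H', resGal (K := K) L σ = g :=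
  Subgroup.mem_map

omit [Algebra.IsAlgebraic K L] [PerfectField L] in
/-- `galImage L H′ ≤ galRange L`. [cite: SerreGaloisCohomology1997, II.§1.1] -/
theorem galImage_le_galRange : galImage K L H' ≤ galRange (K := K) L := by
  rintro _ ⟨σ, -, rfl⟩
  exact ⟨σ, rfl⟩

omit [PerfectField L] in
/-- `resGal σ ∈ galImage H′ ↔ σ ∈ H′` (`resGal` is injective). [cite: SerreGaloisCohomology1997, II.§1.1] -/
theorem resGal_mem_galImage_iff (σ : Field.absoluteGaloisGroup L) : resGal (K := K) L σ ∈ galImage K L H' ↔ σ ∈ H' := by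
  constructor
  · rintro ⟨τ, hτ, h⟩
    rwa [← resGal_injective L h]
  · exact fun h ↦ ⟨σ, h, rfl⟩

/-- `H′ → galImage H′`, `σ ↦ resGal σ` (continuous). [cite: SerreGaloisCohomology1997, II.§1.1] -/
def toGalImage : H' →ₜ* galImage K L H' where
  toFun σ := ⟨resGal (K := K) L σ, σ, σ.2, rfl⟩
  map_one' := Subtype.ext (map_one _)
  map_mul' _ _ := Subtype.ext (map_mul _ _ _)
  continuous_toFun := ((resGal (K := K) L).continuous_toFun.comp continuous_subtype_val).subtype_mk _

omit [Algebra.IsAlgebraic K L] [PerfectField L] in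
/-- Values of `toGalImage`. [cite: SerreGaloisCohomology1997, II.§1.1] -/
@[simp]
theorem coe_toGalImage (σ : H') :
    ((toGalImage K L H' σ : galImage K L H') : Field.absoluteGaloisGroup K) = resGal (K := K) L σ :=
  rfl

/-- `rangeToResGal` maps `galImage H′` into `H′`. [cite: SerreGaloisCohomology1997, II.§1.1] -/
theorem rangeToResGal_mem (n : galImage K L H') :
    rangeToResGal (K := K) L ⟨n, galImage_le_galRange K L H' n.2⟩ ∈ H' := by
  obtain ⟨σ, hσ, hσn⟩ := (mem_galImage_iff K L H' n).mp n.2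
  have h : (⟨(n : Field.absoluteGaloisGroup K), galImage_le_galRange K L H' n.2⟩ : galRange (K := K) L) =
      resGalToRange (K := K) L σ := Subtype.ext hσn.symm
  rw [h, rangeToResGal_resGalToRange]
  exact hσ

/-- `galImage H′ → H′`, the inverse of `toGalImage` (continuous: `rangeToResGal`). [cite: SerreGaloisCohomology1997, II.§1.1] -/
def ofGalImage : galImage K L H' →ₜ* H' where
  toFun n := ⟨rangeToResGal (K := K) L (Subgroup.inclusion (galImage_le_galRange K L H') n), rangeToResGal_mem K L H' n⟩
  map_one' := Subtype.ext (by
    show rangeToResGal (K := K) L (Subgroup.inclusion (galImage_le_galRange K L H') 1) = 1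
    rw [map_one, map_one])
  map_mul' a b := Subtype.ext (by
    show rangeToResGal (K := K) L (Subgroup.inclusion (galImage_le_galRange K L H') (a * b)) =
      rangeToResGal (K := K) L (Subgroup.inclusion (galImage_le_galRange K L H') a) *
        rangeToResGal (K := K) L (Subgroup.inclusion (galImage_le_galRange K L H') b)
    rw [map_mul, map_mul])
  continuous_toFun :=
    ((rangeToResGal (K := K) L).continuous_toFun.comp (continuous_inclusion (galImage_le_galRange K L H'))).subtype_mk _

/-- Values of `ofGalImage` (definitional). [cite: SerreGaloisCohomology1997, II.§1.1] -/
theorem coe_ofGalImage (n : galImage K L H') :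
    ((ofGalImage K L H' n : H') : Field.absoluteGaloisGroup L) =
      rangeToResGal (K := K) L (Subgroup.inclusion (galImage_le_galRange K L H') n) :=
  rfl

/-- `resGal (ofGalImage n) = n`. [cite: SerreGaloisCohomology1997, II.§1.1] -/
theorem resGal_ofGalImage (n : galImage K L H') :
    resGal (K := K) L ((ofGalImage K L H' n : H') : Field.absoluteGaloisGroup L) = (n : Field.absoluteGaloisGroup K) := by
  rw [coe_ofGalImage]
  exact resGal_rangeToResGal L (Subgroup.inclusion (galImage_le_galRange K L H') n)

/-- `ofGalImage ∘ toGalImage = id`. [cite: SerreGaloisCohomology1997, II.§1.1] -/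
@[simp]
theorem ofGalImage_toGalImage (σ : H') : ofGalImage K L H' (toGalImage K L H' σ) = σ := by
  apply Subtype.ext
  apply resGal_injective (K := K) L
  rw [resGal_ofGalImage, coe_toGalImage]

/-- `toGalImage ∘ ofGalImage = id`. [cite: SerreGaloisCohomology1997, II.§1.1] -/
@[simp]
theorem toGalImage_ofGalImage (n : galImage K L H') : toGalImage K L H' (ofGalImage K L H' n) = n :=
  Subtype.ext (resGal_ofGalImage K L H' n)

variable (W : WeierstrassCurve K) (p : ℕ)

/-- Compatibility of the pair `(ofGalImage, primaryBaseChangeEquiv⁻¹)`. [cite: SerreGaloisCohomology1997, I.§2.4] -/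
theorem primaryBaseChangeEquiv_symm_smul_ofGalImage (n : galImage K L H') (Q : geomPrimaryTorsion (W.baseChange L) p) :
    (primaryBaseChangeEquiv L W p).symm (ofGalImage K L H' n • Q) = n • (primaryBaseChangeEquiv L W p).symm Q := by
  rw [Subgroup.smul_def, Subgroup.smul_def]
  change (primaryBaseChangeEquiv L W p).symm (rangeToResGal (K := K) L ⟨n, galImage_le_galRange K L H' n.2⟩ • Q) = _
  rw [primaryBaseChangeEquiv_symm_smul, Subgroup.smul_def]

omit [PerfectField L] in
/-- Compatibility of the pair `(toGalImage, primaryBaseChangeEquiv)`. [cite: SerreGaloisCohomology1997, I.§2.4] -/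
theorem primaryBaseChangeEquiv_smul_toGalImage (σ : H') (P : geomPrimaryTorsion W p) :
    primaryBaseChangeEquiv L W p (toGalImage K L H' σ • P) = σ • primaryBaseChangeEquiv L W p P := by
  rw [Subgroup.smul_def, Subgroup.smul_def, coe_toGalImage]
  have h := primaryBaseChangeEquiv_smul L W p (σ : Field.absoluteGaloisGroup L) P
  rw [Subgroup.smul_def, coe_resGalToRange] at h
  exact h

/-- **The subgroup model of `H¹(L̄^{H′}, E_L[p^∞])`**: `H¹(H′, E_L[p^∞]) ≃+ H¹(galImage H′, E[p^∞])` for `H′ ≤ Γ_L`,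
`L/K` algebraic — the maps of the mutually inverse compatible pairs `(ofGalImage, primaryBaseChangeEquiv⁻¹)` and
`(toGalImage, primaryBaseChangeEquiv)` (the case `H′ = Γ_L` is `modelIso`). [cite: SerreGaloisCohomology1997, I.§2.4 and II.§1.1] -/
def subgroupModelIso : (W.baseChange L).subgroupH1 p H' ≃+ W.subgroupH1 p (galImage K L H') where
  toFun := resH1Hom (ofGalImage K L H') (primaryBaseChangeEquiv L W p).symm.toAddMonoidHom
    (primaryBaseChangeEquiv_symm_smul_ofGalImage K L H' W p)
  invFun := resH1Hom (toGalImage K L H') (primaryBaseChangeEquiv L W p).toAddMonoidHom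
    (primaryBaseChangeEquiv_smul_toGalImage K L H' W p)
  left_inv x := by
    rw [resH1Hom_resH1Hom]
    have e : resH1Hom ((ofGalImage K L H').comp (toGalImage K L H'))
        ((primaryBaseChangeEquiv L W p).toAddMonoidHom.comp (primaryBaseChangeEquiv L W p).symm.toAddMonoidHom)
        (fun x m ↦ by
          simp only [AddMonoidHom.coe_comp, Function.comp_apply, AddEquiv.coe_toAddMonoidHom,
            ContinuousMonoidHom.comp_toFun, primaryBaseChangeEquiv_symm_smul_ofGalImage,
            primaryBaseChangeEquiv_smul_toGalImage, AddEquiv.apply_symm_apply]) =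
          resH1Hom (ContinuousMonoidHom.id _) (AddMonoidHom.id _) (fun _ _ ↦ rfl) :=
      resH1Hom_congr (ContinuousMonoidHom.ext fun σ ↦ ofGalImage_toGalImage K L H' σ)
        (by ext Q; exact congrArg Subtype.val ((primaryBaseChangeEquiv L W p).apply_symm_apply Q)) _ _
    rw [e, resH1Hom_id]
    rfl
  right_inv x := by
    rw [resH1Hom_resH1Hom]
    have e : resH1Hom ((toGalImage K L H').comp (ofGalImage K L H'))
        ((primaryBaseChangeEquiv L W p).symm.toAddMonoidHom.comp (primaryBaseChangeEquiv L W p).toAddMonoidHom)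
        (fun x m ↦ by
          simp only [AddMonoidHom.coe_comp, Function.comp_apply, AddEquiv.coe_toAddMonoidHom,
            ContinuousMonoidHom.comp_toFun, primaryBaseChangeEquiv_symm_smul_ofGalImage,
            primaryBaseChangeEquiv_smul_toGalImage, AddEquiv.symm_apply_apply]) =
          resH1Hom (ContinuousMonoidHom.id _) (AddMonoidHom.id _) (fun _ _ ↦ rfl) :=
      resH1Hom_congr (ContinuousMonoidHom.ext fun n ↦ toGalImage_ofGalImage K L H' n)
        (by ext P; exact congrArg Subtype.val ((primaryBaseChangeEquiv L W p).symm_apply_apply P)) _ _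
    rw [e, resH1Hom_id]
    rfl
  map_add' := map_add _

/-- `subgroupModelIso` as a function. [cite: SerreGaloisCohomology1997, I.§2.4] -/
theorem subgroupModelIso_apply (x : (W.baseChange L).subgroupH1 p H') :
    subgroupModelIso K L H' W p x = resH1Hom (ofGalImage K L H') (primaryBaseChangeEquiv L W p).symm.toAddMonoidHom
      (primaryBaseChangeEquiv_symm_smul_ofGalImage K L H' W p) x :=
  rfl

/-- **`subgroupModelIso` is `conj`-equivariant**: `Θ (conj_σ x) = conj_{resGal σ} (Θ x)` for `σ ∈ Γ_L` (both are maps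
of the same compatible pair `H¹(H′, E_L[p^∞]) → H¹(galImage H′, E[p^∞])`: `n ↦ σ⁻¹ (ofGalImage n) σ` and
`Q ↦ (resGal σ) • e⁻¹ Q = e⁻¹ (σ • Q)`). [cite: SerreGaloisCohomology1997, I.§2.5] -/
theorem subgroupModelIso_conjH1 [H'.Normal] [(galImage K L H').Normal] (σ : Field.absoluteGaloisGroup L)
    (x : (W.baseChange L).subgroupH1 p H') :
    subgroupModelIso K L H' W p ((W.baseChange L).conjH1 p H' σ x) =
      W.conjH1 p (galImage K L H') (resGal (K := K) L σ) (subgroupModelIso K L H' W p x) := by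
  have hcoef : ∀ Q : geomPrimaryTorsion (W.baseChange L) p,
      (primaryBaseChangeEquiv L W p).symm (σ • Q) = resGal (K := K) L σ • (primaryBaseChangeEquiv L W p).symm Q := by
    intro Q
    apply (primaryBaseChangeEquiv L W p).injective
    rw [AddEquiv.apply_symm_apply]
    have h := primaryBaseChangeEquiv_smul L W p σ ((primaryBaseChangeEquiv L W p).symm Q)
    rw [Subgroup.smul_def, coe_resGalToRange, AddEquiv.apply_symm_apply] at h
    exact h.symm
  rw [subgroupModelIso_apply, subgroupModelIso_apply]
  unfold WeierstrassCurve.conjH1 Literature.NumberTheory.EllipticCurves.conjH1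
  rw [resH1Hom_resH1Hom, resH1Hom_resH1Hom]
  refine congrFun (congrArg DFunLike.coe (resH1Hom_congr ?_ ?_ _ _)) x
  · apply ContinuousMonoidHom.ext
    intro n
    apply Subtype.ext
    apply resGal_injective (K := K) L
    change resGal (K := K) L (σ⁻¹ * (ofGalImage K L H' n : H') * σ) =
      resGal (K := K) L (ofGalImage K L H' (subgroupConj (galImage K L H') (resGal (K := K) L σ) n) : H')
    rw [map_mul, map_mul, map_inv, resGal_ofGalImage, resGal_ofGalImage, subgroupConj_apply_coe]
  · apply AddMonoidHom.ext
    intro Q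
    exact hcoef Q

end Model

/-! ## §2 The local condition at a common `L`-field `E` -/

section Local

variable (K : Type u) [Field K] (L : Type u) [Field L] [Algebra K L] [Algebra.IsAlgebraic K L] [PerfectField L]
  (H' : Subgroup (Field.absoluteGaloisGroup L)) (W : WeierstrassCurve K) (p : ℕ)
  {E : Type u} [Field E] [Algebra K E] [Algebra L E] [IsScalarTower K L E]
  (ι' : AlgebraicClosure L →ₐ[L] AlgebraicClosure E)

/-- The composite `K`-embedding `ι = ι′ ∘ closureEmb L : K̄ → L̄ → Ē` attached to an `L`-embedding `ι′ : L̄ → Ē`.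
[cite: SerreGaloisCohomology1997, II.§1.1] -/
def compEmb : AlgebraicClosure K →ₐ[K] AlgebraicClosure E :=
  (ι'.restrictScalars K).comp (closureEmb (K := K) L)

omit [Algebra.IsAlgebraic K L] [PerfectField L] in
/-- `res_{ι′ ∘ closureEmb L} = resGal L ∘ res_{ι′}` on `Γ_E` (`resGalOfEmb_comp_tower`, `resGal_eq`).
[cite: SerreGaloisCohomology1997, II.§1.1] -/
theorem resGalOfEmb_compEmb (τ : Field.absoluteGaloisGroup E) :
    resGalOfEmb (compEmb K L ι') τ = resGal (K := K) L (resGalOfEmb (K := L) ι' τ) := by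
  have h := resGalOfEmb_comp_tower (closureEmb (K := K) L) ι'
  rw [compEmb, h, ← resGal_eq]
  rfl

omit [PerfectField L] in
/-- **The local subgroups coincide**: `(galImage H′)_{ι′ ∘ closureEmb L} = (H′)_{ι′}` in `Γ_E`.
[cite: SerreGaloisCohomology1997, II.§1.1] -/
theorem localSubgroupOfEmb_galImage_eq :
    localSubgroupOfEmb (galImage K L H') (compEmb K L ι') = localSubgroupOfEmb H' ι' := by
  ext τ
  rw [mem_localSubgroupOfEmb_iff, mem_localSubgroupOfEmb_iff, resGalOfEmb_compEmb, resGal_mem_galImage_iff]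

/-- The identity `(H′)_{ι′} → (galImage H′)_ι` of local subgroups, as a continuous monoid homomorphism.
[cite: SerreGaloisCohomology1997, II.§1.1] -/
def localIncl : localSubgroupOfEmb H' ι' →ₜ* localSubgroupOfEmb (galImage K L H') (compEmb K L ι') :=
  subgroupInclusion (le_of_eq (localSubgroupOfEmb_galImage_eq K L H' ι').symm)

/-- The inverse identity. [cite: SerreGaloisCohomology1997, II.§1.1] -/
def localIncl' : localSubgroupOfEmb (galImage K L H') (compEmb K L ι') →ₜ* localSubgroupOfEmb H' ι' :=
  subgroupInclusion (le_of_eq (localSubgroupOfEmb_galImage_eq K L H' ι'))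

/-- The identification of local coefficient modules `E(Ē) ≃+ E_L(Ē)` (identity on coordinates, `pointsCongr`).
[cite: SerreGaloisCohomology1997, I.§2.4] -/
def localCoeff : localPoints W E ≃+ localPoints (W.baseChange L) E :=
  pointsCongr W L (AlgebraicClosure E)

omit [Algebra.IsAlgebraic K L] [PerfectField L] in
/-- `localCoeff` is `Γ_E`-equivariant. [cite: SerreGaloisCohomology1997, I.§2.4] -/
theorem localCoeff_smul (τ : Field.absoluteGaloisGroup E) (P : localPoints W E) :
    localCoeff K L W (τ • P) = τ • localCoeff K L W P := by
  rw [localPoints.smul_def, localPoints.smul_def]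
  exact pointsCongr_map W L
    ((AlgEquiv.restrictScalars L (show AlgebraicClosure E ≃ₐ[E] AlgebraicClosure E from τ)) :
      AlgebraicClosure E →ₐ[L] AlgebraicClosure E) P

omit [PerfectField L] in
/-- The local square of coefficient maps: `localCoeff (ι_* P) = ι′_* (e P)` on `E[p^∞](K̄)`, `e = primaryBaseChangeEquiv`.
[cite: SerreGaloisCohomology1997, I.§2.4] -/
theorem localCoeff_pointsMapOfEmb (P : geomPrimaryTorsion W p) :
    localCoeff K L W (pointsMapOfEmb W (compEmb K L ι') (P : geomPoints W)) =
      pointsMapOfEmb (W.baseChange L) ι' ((primaryBaseChangeEquiv L W p P : geomPrimaryTorsion (W.baseChange L) p) :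
        geomPoints (W.baseChange L)) := by
  rw [primaryBaseChangeEquiv_apply, coe_primaryBaseChangeMap, compEmb, pointsMapOfEmb_comp_tower]
  exact pointsCongr_map W L (Ω := AlgebraicClosure L) (Ω' := AlgebraicClosure E) ι' (pointsMap W L (P : geomPoints W))

/-- The transport of local `H¹`: `H¹((H′)_{ι′}, E_L(Ē)) → H¹((galImage H′)_ι, E(Ē))` along `(localIncl′⁻¹ = localIncl, localCoeff⁻¹)`,
an injective map (it has the left inverse along `(localIncl′, localCoeff)`). [cite: SerreGaloisCohomology1997, I.§2.4] -/
def localTransport :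
    discreteH1 (localSubgroupOfEmb H' ι') (localPoints (W.baseChange L) E) →+
      discreteH1 (localSubgroupOfEmb (galImage K L H') (compEmb K L ι')) (localPoints W E) :=
  resH1Hom (localIncl' K L H' ι') (localCoeff K L W (E := E)).symm.toAddMonoidHom fun τ Q ↦ by
    apply (localCoeff K L W (E := E)).injective
    rw [AddEquiv.coe_toAddMonoidHom, AddEquiv.apply_symm_apply, Subgroup.smul_def, Subgroup.smul_def, localCoeff_smul,
      AddEquiv.apply_symm_apply]
    rfl

omit [PerfectField L] in
/-- `localTransport` is injective (left inverse along the inverse pair). [cite: SerreGaloisCohomology1997, I.§2.4] -/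
theorem localTransport_injective : Function.Injective (localTransport K L H' W ι') := by
  let back : discreteH1 (localSubgroupOfEmb (galImage K L H') (compEmb K L ι')) (localPoints W E) →+
      discreteH1 (localSubgroupOfEmb H' ι') (localPoints (W.baseChange L) E) :=
    resH1Hom (localIncl K L H' ι') (localCoeff K L W (E := E)).toAddMonoidHom fun τ P ↦ by
      rw [AddEquiv.coe_toAddMonoidHom, Subgroup.smul_def, Subgroup.smul_def, localCoeff_smul]; rfl
  have hleft : ∀ z, back (localTransport K L H' W ι' z) = z := fun z ↦ by
    change resH1Hom _ _ _ (resH1Hom _ _ _ z) = z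
    rw [resH1Hom_resH1Hom]
    have e : resH1Hom ((localIncl' K L H' ι').comp (localIncl K L H' ι'))
        ((localCoeff K L W (E := E)).toAddMonoidHom.comp (localCoeff K L W (E := E)).symm.toAddMonoidHom)
        (fun x m ↦ by
          simp only [AddMonoidHom.coe_comp, Function.comp_apply, AddEquiv.coe_toAddMonoidHom,
            AddEquiv.apply_symm_apply]; rfl) =
          resH1Hom (ContinuousMonoidHom.id _) (AddMonoidHom.id _) (fun _ _ ↦ rfl) :=
      resH1Hom_congr (by ext; rfl) (by ext Q; exact (localCoeff K L W (E := E)).apply_symm_apply Q) _ _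
    rw [e, resH1Hom_id]; rfl
  intro a b h
  rw [← hleft a, ← hleft b, h]

/-- **The local restriction maps correspond under the subgroup model**: `loc^K_{ι} ∘ Θ = localTransport ∘ loc^L_{ι′}` on
`H¹(H′, E_L[p^∞])` (both are the map of the compatible pair `((H′)_{ι′} → H′, E_L[p^∞] → E(Ē))` along
`Γ_E → Γ_L → Γ_K`). [cite: SerreGaloisCohomology1997, I.§2.4 and II.§1.1] -/
theorem localResOverOfEmb_subgroupModelIso (x : (W.baseChange L).subgroupH1 p H') :
    W.localResOverOfEmb p (galImage K L H') (compEmb K L ι') (subgroupModelIso K L H' W p x) =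
      localTransport K L H' W ι' ((W.baseChange L).localResOverOfEmb p H' ι' x) := by
  simp only [subgroupModelIso_apply, WeierstrassCurve.localResOverOfEmb, localTransport, resH1Hom_resH1Hom]
  refine congrFun (congrArg DFunLike.coe (resH1Hom_congr ?_ ?_ _ _)) x
  · apply ContinuousMonoidHom.ext
    intro τ
    apply Subtype.ext
    apply resGal_injective (K := K) L
    change resGal (K := K) L (ofGalImage K L H' (resGalSubgroupOfEmb (galImage K L H') (compEmb K L ι') τ) : H') =
      resGal (K := K) L (resGalSubgroupOfEmb H' ι' (localIncl' K L H' ι' τ) : H')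
    rw [resGal_ofGalImage, resGalSubgroupOfEmb_apply_coe, resGalSubgroupOfEmb_apply_coe, resGalOfEmb_compEmb]
    rfl
  · ext P
    change pointsMapOfEmb W (compEmb K L ι') (((primaryBaseChangeEquiv L W p).symm P : geomPrimaryTorsion W p) : geomPoints W) =
      (localCoeff K L W (E := E)).symm (pointsMapOfEmb (W.baseChange L) ι' (P : geomPoints (W.baseChange L)))
    apply (localCoeff K L W (E := E)).injective
    rw [AddEquiv.apply_symm_apply, localCoeff_pointsMapOfEmb, AddEquiv.apply_symm_apply]

/-- **THE LOCAL SELMER CONDITIONS CORRESPOND at a common `L`-field `E`**: `x ∈ H¹(H′, E_L[p^∞])` dies in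
`H¹((H′)_{ι′}, E_L(Ē))` iff `subgroupModelIso x` dies in `H¹((galImage H′)_{ι′ ∘ closureEmb L}, E(Ē))`.
[cite: SerreGaloisCohomology1997, I.§2.4 and II.§1.1] [cite: GreenbergLNM1716, §2] -/
theorem mem_localKerOverOfEmb_iff_subgroupModelIso_mem (x : (W.baseChange L).subgroupH1 p H') :
    x ∈ (W.baseChange L).localKerOverOfEmb p H' ι' ↔
      subgroupModelIso K L H' W p x ∈ W.localKerOverOfEmb p (galImage K L H') (compEmb K L ι') := by
  constructor
  · intro h
    have h' : (W.baseChange L).localResOverOfEmb p H' ι' x = 0 := h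
    show W.localResOverOfEmb p (galImage K L H') (compEmb K L ι') (subgroupModelIso K L H' W p x) = 0
    rw [localResOverOfEmb_subgroupModelIso, h', map_zero]
  · intro h
    have h' : W.localResOverOfEmb p (galImage K L H') (compEmb K L ι') (subgroupModelIso K L H' W p x) = 0 := h
    rw [localResOverOfEmb_subgroupModelIso] at h'
    show (W.baseChange L).localResOverOfEmb p H' ι' x = 0
    exact localTransport_injective K L H' W ι' (h'.trans (map_zero _).symm)

end Local

/-! ## §3 Towers of local fields in the base-`K` model -/

section Tower

variable {K : Type u} [Field K] (W : WeierstrassCurve K) (p : ℕ) (H : Subgroup (Field.absoluteGaloisGroup K))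
  {E₁ : Type u} [Field E₁] [Algebra K E₁] {E₂ : Type u} [Field E₂] [Algebra K E₂] [Algebra E₁ E₂] [IsScalarTower K E₁ E₂]
  (ι₁ : AlgebraicClosure K →ₐ[K] AlgebraicClosure E₁) (ι₂ : AlgebraicClosure E₁ →ₐ[E₁] AlgebraicClosure E₂)

/-- Pointwise form of `resGalOfEmb_comp_tower`. [cite: SerreGaloisCohomology1997, II.§1.1] -/
private theorem resGalOfEmb_comp_tower_apply (τ : Field.absoluteGaloisGroup E₂) :
    resGalOfEmb ((ι₂.restrictScalars K).comp ι₁) τ = resGalOfEmb ι₁ (resGalOfEmb (K := E₁) ι₂ τ) := by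
  rw [resGalOfEmb_comp_tower]; rfl

/-- `res_{ι₂}` maps `(H)_{ι₂∘ι₁}` into `(H)_{ι₁}`. [cite: SerreGaloisCohomology1997, II.§1.1] -/
private theorem resGalOfEmb_mem_localSubgroupOfEmb (τ : localSubgroupOfEmb H ((ι₂.restrictScalars K).comp ι₁)) :
    resGalOfEmb (K := E₁) ι₂ (τ : Field.absoluteGaloisGroup E₂) ∈ localSubgroupOfEmb H ι₁ := by
  have h : resGalOfEmb ((ι₂.restrictScalars K).comp ι₁) (τ : Field.absoluteGaloisGroup E₂) ∈ H := τ.2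
  rw [resGalOfEmb_comp_tower_apply] at h
  exact h

/-- The restriction of local subgroups `(H)_{ι₂∘ι₁} → (H)_{ι₁}` along `Γ_{E₂} → Γ_{E₁}` (`resGalOfEmb ι₂`).
[cite: SerreGaloisCohomology1997, II.§1.1] -/
def localResTower : localSubgroupOfEmb H ((ι₂.restrictScalars K).comp ι₁) →ₜ* localSubgroupOfEmb H ι₁ where
  toFun τ := ⟨resGalOfEmb (K := E₁) ι₂ τ, resGalOfEmb_mem_localSubgroupOfEmb H ι₁ ι₂ τ⟩
  map_one' := Subtype.ext (map_one _)
  map_mul' _ _ := Subtype.ext (map_mul _ _ _)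
  continuous_toFun := ((resGalOfEmb (K := E₁) ι₂).continuous_toFun.comp continuous_subtype_val).subtype_mk _

/-- **The local restriction at `E₂` factors through the one at `E₁`**: `loc_{ι₂∘ι₁} = (res_{ι₂}, (ι₂)_*)_* ∘ loc_{ι₁}`.
[cite: SerreGaloisCohomology1997, I.§2.4 and II.§1.1] -/
theorem localResOverOfEmb_tower (x : W.subgroupH1 p H) :
    W.localResOverOfEmb p H ((ι₂.restrictScalars K).comp ι₁) x =
      resH1Hom (localResTower H ι₁ ι₂) (pointsMapTower W ι₂) (fun τ P ↦ pointsMapTower_smul W ι₂ τ P)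
        (W.localResOverOfEmb p H ι₁ x) := by
  simp only [WeierstrassCurve.localResOverOfEmb, resH1Hom_resH1Hom]
  refine congrFun (congrArg DFunLike.coe (resH1Hom_congr ?_ ?_ _ _)) x
  · apply ContinuousMonoidHom.ext
    intro τ
    apply Subtype.ext
    exact resGalOfEmb_comp_tower_apply ι₁ ι₂ τ
  · ext P
    change pointsMapOfEmb W ((ι₂.restrictScalars K).comp ι₁) (P : geomPoints W) = pointsMapTower W ι₂ (pointsMapOfEmb W ι₁ P)
    rw [pointsMapOfEmb_comp_tower]; rfl

/-- **`LK_{H,ι₁}(E₁) ≤ LK_{H,ι₂∘ι₁}(E₂)`**: a class dying at the `K`-field `E₁` dies at every `E₁`-field `E₂` (compatible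
embeddings). [cite: SerreGaloisCohomology1997, I.§2.4] [cite: GreenbergLNM1716, §2] -/
theorem localKerOverOfEmb_le_of_tower :
    W.localKerOverOfEmb p H ι₁ ≤ W.localKerOverOfEmb p H ((ι₂.restrictScalars K).comp ι₁) := by
  intro x hx
  simp only [WeierstrassCurve.localKerOverOfEmb, AddMonoidHom.mem_ker] at hx ⊢
  rw [localResOverOfEmb_tower, hx, map_zero]

end Tower

end BaseChangeModel

end Literature.NumberTheory.EllipticCurves

end
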